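import Literature.Analysis.Complex.AffineHypersurfaceFibreClusters
import Literature.Analysis.Complex.LagrangeInterpolationContour
import Literature.Analysis.Complex.RiemannExtension
import HarnessLib

/-!
# The Lagrange interpolation coefficients of a holomorphic function along a monic projection are entire

Layer `Literature/Analysis/Complex`, sequel of `AffineHypersurfaceFibreClusters` and `LagrangeInterpolationContour`
(setting: `P = Σ_j a_j(w) X^j`, `a_j ∈ ℂ[w₁, …, w_m]`, `P.coeff d = c ≠ 0`, `deg a_j ≤ d - j`, fibre polynomials `P_w`,
hypersurface `U = {(w, t) | P_w(t) = 0}`, and a function `g` on `U` which is locally the restriction of holomorphic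
functions of `ℂ^m × ℂ`). Off the hypersurface `Δ = {δ = 0}` (`δ ≠ 0` a polynomial off whose zeros `P_w` has `d`
DISTINCT roots) let `a_j(w) = [X^j] L_w` be the coefficients of the Lagrange interpolation polynomial `L_w` of
`t ↦ g(w, t)` at the roots of `P_w`. This file proves the key analytic step of Serre's algebraisation lemma on a smooth
affine hypersurface (GAGA n° 19–20, SGA 1 XII 5.1): **the `a_j` extend to ENTIRE functions of `w`**.

* `exists_local_interpolation` — near ANY `w₀` (also on `Δ`) there is a holomorphic `A` with `A = a_j` off `Δ`:
  by Hermite's contour formula (`LagrangeContour.circleIntegral_mul_kernel_eq`) summed over the clusters of roots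
  around the roots `τ` of `P_{w₀}` (`exists_cluster_package`),
  `a_j(w) = Σ_τ (2πi)⁻¹ ∮_{|z-τ|=ε} G_τ(w, z) · (Σ_{i<d-j} a_{j+1+i}(w) z^i) / P_w(z) dz`,
  whose right side is holomorphic in `w` across `Δ` (integrals depending holomorphically on a parameter,
  `SCV.differentiableOn_intervalIntegral_affine`) — this is where the local holomorphic extensions `G_τ` of `g`, i.e.
  the smoothness of `U`, enter;
* `exists_differentiable_eq_coeff_interpolate` — hence `a_j` is holomorphic off `Δ` and locally bounded near `Δ`, so
  it extends to an entire function (Riemann's extension theorem across the thin set `Δ`,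
  `SCV.exists_differentiableOn_eqOn_of_thin`).

Everything is proved; no definitions, no named facts.

## References

* J.-P. Serre, *Géométrie algébrique et géométrie analytique*, Ann. Inst. Fourier 6 (1956), n° 19–20. [SerreGAGA1956]
* D. Gaier, *Lectures on Complex Approximation* (1987), Ch. II §1 (Hermite's interpolation formula). [Gaier1987]
* E. M. Chirka, *Complex Analytic Sets* (1989), §1.3, A1.4 (Riemann extension). [Chirka1989]
-/

noncomputable section

open Polynomial Complex Metric Set Filter Finset Lagrange
open scoped Topology Real

namespace Literature.Analysis.Complex

namespace AffineHypersurface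

open SCV

variable {m d : ℕ} {c : ℂ} (P : Polynomial (MvPolynomial (Fin m) ℂ))

/-- **Off the discriminant the nodal polynomial of the roots is `c⁻¹ P_w`**: when `P_w` (`P.coeff d = c ≠ 0`,
degree `d`) has distinct roots, `∏_{P_w(r)=0} (X - r) = c⁻¹ P_w`, so its value at `z` is `c⁻¹ P_w(z)` and its
coefficients are `c⁻¹ a_n(w)`. [cite: SerreGAGA1956, n° 19 Lemme 8] -/
theorem nodal_roots_toFinset_eq (hc : c ≠ 0) (hPd : P.natDegree ≤ d) (hPlead : P.coeff d = MvPolynomial.C c)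
    {w : Fin m → ℂ} (hnd : (P.map (MvPolynomial.eval w)).roots.Nodup) :
    nodal (P.map (MvPolynomial.eval w)).roots.toFinset id = Polynomial.C c⁻¹ * P.map (MvPolynomial.eval w) := by
  classical
  obtain ⟨hdeg, hlc⟩ := natDegree_map_eval_eq P hc hPd hPlead w
  have hsplit := C_leadingCoeff_mul_prod_multiset_X_sub_C
    ((card_roots_map_eval P hc hPd hPlead w).trans hdeg.symm)
  rw [hlc] at hsplit
  have hprod : nodal (P.map (MvPolynomial.eval w)).roots.toFinset id =
      ((P.map (MvPolynomial.eval w)).roots.map fun a ↦ X - Polynomial.C a).prod := by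
    rw [nodal_eq, Finset.prod_eq_multiset_prod, Multiset.toFinset_val, Multiset.dedup_eq_self.mpr hnd]
    rfl
  rw [hprod]
  conv_rhs => rw [← hsplit]
  rw [← mul_assoc, ← Polynomial.C_mul, inv_mul_cancel₀ hc, Polynomial.C_1, one_mul]

/-- **Local holomorphic representative of the interpolation coefficients** (Hermite's formula over the clusters).
Around every `w₀` there are a ball `B` and a holomorphic `A` on `B` such that `A(w) = [X^j] L_w` for every `w ∈ B` at
which `P_w` has distinct roots, `L_w` the Lagrange interpolant of `g(w, ·)` at those roots.
[cite: Gaier1987, Ch. II §1 (Hermite's interpolation formula)] [cite: SerreGAGA1956, n° 20] -/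
theorem exists_local_interpolation (hc : c ≠ 0) (hPd : P.natDegree ≤ d) (hPlead : P.coeff d = MvPolynomial.C c)
    {L : ℝ} (hL : 1 ≤ L)
    (hroot : ∀ (w : Fin m → ℂ) (t : ℂ), (P.map (MvPolynomial.eval w)).IsRoot t → ‖t‖ ≤ L * (1 + ‖w‖))
    {g : (Fin m → ℂ) × ℂ → ℂ}
    (hhol : ∀ x : (Fin m → ℂ) × ℂ, (P.map (MvPolynomial.eval x.1)).eval x.2 = 0 →
      ∃ W : Set ((Fin m → ℂ) × ℂ), IsOpen W ∧ x ∈ W ∧ ∃ G : (Fin m → ℂ) × ℂ → ℂ, DifferentiableOn ℂ G W ∧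
        ∀ y ∈ W, (P.map (MvPolynomial.eval y.1)).eval y.2 = 0 → G y = g y)
    (j : ℕ) (w₀ : Fin m → ℂ) :
    ∃ δ' > 0, ∃ A : (Fin m → ℂ) → ℂ, DifferentiableOn ℂ A (ball w₀ δ') ∧
      ∀ w ∈ ball w₀ δ', (P.map (MvPolynomial.eval w)).roots.Nodup →
        A w = (interpolate (P.map (MvPolynomial.eval w)).roots.toFinset id fun r ↦ g (w, r)).coeff j := by
  classical
  set f : (Fin m → ℂ) × ℂ → ℂ := fun x ↦ (P.map (MvPolynomial.eval x.1)).eval x.2 with hf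
  obtain ⟨ε, hε, -, δ, hδ, -, G, hsep, hV, hG, hGg, -, hsplit⟩ :=
    exists_cluster_package P hc hPd hPlead hL hroot hhol w₀
  set S₀ := (P.map (MvPolynomial.eval w₀)).roots.toFinset with hS₀
  -- the kernel with polynomial coefficients: `(Σ_i c⁻¹ a_{j+1+i}(w) z^i) / (c⁻¹ P_w(z))`
  set num : (Fin m → ℂ) × ℂ → ℂ := fun x ↦
    ∑ i ∈ range (d - j), c⁻¹ * MvPolynomial.eval x.1 (P.coeff (j + 1 + i)) * x.2 ^ i with hnum
  set H : ℂ → (Fin m → ℂ) × ℂ → ℂ := fun τ x ↦ G τ x * (num x * (c⁻¹ * f x)⁻¹) with hH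
  refine ⟨δ, hδ, fun w ↦ ∑ τ ∈ S₀, (2 * π * I)⁻¹ * ∮ z in C(τ, ε), H τ (w, z), ?_, ?_⟩
  · -- holomorphy in the parameter
    refine DifferentiableOn.fun_sum fun τ hτ ↦ DifferentiableOn.const_mul ?_ _
    set O : Set ((Fin m → ℂ) × ℂ) := {x ∈ ball w₀ δ ×ˢ ball τ (2 * ε) | f x ≠ 0} with hO
    have hOopen : IsOpen O :=
      (differentiable_fibre P).continuous.continuousOn.isOpen_inter_preimage (isOpen_ball.prod isOpen_ball)
        isOpen_compl_singleton
    have hnumd : Differentiable ℂ num := by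
      refine Differentiable.fun_sum fun i _ ↦ ?_
      have h1 : Differentiable ℂ fun x : (Fin m → ℂ) × ℂ ↦ MvPolynomial.eval x.1 (P.coeff (j + 1 + i)) :=
        (BranchedCoveringSCV.differentiable_eval (P.coeff (j + 1 + i))).comp differentiable_fst
      exact ((differentiable_const _).mul h1).mul (differentiable_snd.pow i)
    have hHd : DifferentiableOn ℂ (H τ) O := by
      refine ((hG τ hτ).mono fun x hx ↦ hx.1).mul (hnumd.differentiableOn.mul ?_)
      refine DifferentiableOn.inv ((differentiable_fibre P).differentiableOn.const_mul _) fun x hx ↦ ?_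
      exact mul_ne_zero (inv_ne_zero hc) hx.2
    set Lw : (Fin m → ℂ) →L[ℂ] (Fin m → ℂ) × ℂ := ContinuousLinearMap.inl ℂ (Fin m → ℂ) ℂ with hLw
    set p : ℝ → (Fin m → ℂ) × ℂ := fun θ ↦ ((0 : Fin m → ℂ), circleMap τ ε θ) with hp
    have hpc : Continuous p := continuous_const.prodMk (continuous_circleMap τ ε)
    have hLp : ∀ (w : Fin m → ℂ) (θ : ℝ), Lw w + p θ = (w, circleMap τ ε θ) := by intro w θ; simp [hLw, hp]
    have hΦ : DifferentiableOn ℂ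
        (fun w ↦ ∫ θ in (0 : ℝ)..2 * π, (circleMap 0 ε θ * I) • H τ (Lw w + p θ)) (ball w₀ δ) := by
      refine differentiableOn_intervalIntegral_affine hHd hOopen Lw hpc
        ((continuous_circleMap 0 ε).mul continuous_const) fun w hw θ _ ↦ ?_
      rw [hLp]
      have hs : circleMap τ ε θ ∈ sphere τ ε := circleMap_mem_sphere τ hε.le θ
      refine ⟨mk_mem_prod hw ?_, (hV τ hτ).ne_zero w hw _ hs⟩
      rw [mem_sphere] at hs
      exact mem_ball.mpr (by linarith)
    refine hΦ.congr fun w hw ↦ ?_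
    simp only [circleIntegral, deriv_circleMap, hLp, smul_eq_mul]
  · -- agreement with the interpolation coefficients off the discriminant
    intro w hw hnd
    beta_reduce
    set R := (P.map (MvPolynomial.eval w)).roots.toFinset with hR
    have hne0 := map_eval_ne_zero P hc hPlead w
    have hRcard : R.card = d := by
      rw [hR, Multiset.toFinset_card_of_nodup hnd, card_roots_map_eval P hc hPd hPlead]
    have hnodal := nodal_roots_toFinset_eq P hc hPd hPlead hnd
    have hRroot : ∀ r ∈ R, f (w, r) = 0 := fun r hr ↦ (mem_roots hne0).mp (Multiset.mem_toFinset.mp hr)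
    -- every root lies in exactly one cluster disc
    have hRball : ∀ r ∈ R, ∃ τ ∈ S₀, r ∈ ball τ ε := by
      intro r hr
      have hr' : r ∈ (P.map (MvPolynomial.eval w)).roots := Multiset.mem_toFinset.mp hr
      rw [hsplit w hw, Multiset.mem_sum] at hr'
      obtain ⟨τ, hτ, hrτ⟩ := hr'
      exact ⟨τ, hτ, mem_ball_of_mem_rootMultiset hrτ⟩
    have huniq : ∀ r, ∀ τ ∈ S₀, ∀ τ' ∈ S₀, r ∈ ball τ ε → r ∈ ball τ' ε → τ = τ' := by
      intro r τ hτ τ' hτ' h1 h2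
      by_contra hne
      have := hsep τ (Multiset.mem_toFinset.mp hτ) τ' (Multiset.mem_toFinset.mp hτ') hne
      rw [mem_ball] at h1 h2
      linarith [dist_triangle_left τ τ' r]
    -- the kernel is the one of `LagrangeContour`
    have hker : ∀ z, num (w, z) * (c⁻¹ * f (w, z))⁻¹ =
        (∑ i ∈ range (R.card - j), (nodal R id).coeff (j + 1 + i) * z ^ i) / (nodal R id).eval z := by
      intro z
      rw [hRcard, hnodal, div_eq_mul_inv]
      simp only [hnum, hf, coeff_C_mul, coeff_map, eval_mul, eval_C]
    -- contour formula on each cluster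
    have hclus : ∀ τ ∈ S₀, (2 * π * I)⁻¹ * (∮ z in C(τ, ε), H τ (w, z)) =
        ∑ r ∈ R with dist r τ < ε, g (w, r) * (nodalWeight R id r * (nodal (R.erase r) id).coeff j) := by
      intro τ hτ
      have hGz : DifferentiableOn ℂ (fun z ↦ G τ (w, z)) (closedBall τ ε) :=
        (hG τ hτ).comp (by fun_prop) fun z hz ↦ mk_mem_prod hw (closedBall_subset_ball (by linarith) hz)
      have hRs : ∀ r ∈ R, r ∉ sphere τ ε := by
        intro r hr hrs
        obtain ⟨τ', hτ', hrτ'⟩ := hRball r hr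
        have hne : τ' ≠ τ := by
          rintro rfl; rw [mem_sphere] at hrs; rw [mem_ball] at hrτ'; linarith
        have := hsep τ' (Multiset.mem_toFinset.mp hτ') τ (Multiset.mem_toFinset.mp hτ) hne
        rw [mem_sphere] at hrs; rw [mem_ball] at hrτ'
        linarith [dist_triangle_left τ' τ r]
      have hint : (∮ z in C(τ, ε), H τ (w, z)) = ∮ z in C(τ, ε), G τ (w, z) *
          ((∑ i ∈ range (R.card - j), (nodal R id).coeff (j + 1 + i) * z ^ i) / (nodal R id).eval z) := by
        refine circleIntegral.integral_congr hε.le fun z _ ↦ ?_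
        simp only [hH, hker z]
      rw [hint, LagrangeContour.circleIntegral_mul_kernel_eq R j hε hGz hRs, ← mul_assoc, inv_mul_cancel₀
        two_pi_I_ne_zero, one_mul]
      refine Finset.sum_congr rfl fun r hr ↦ ?_
      rw [Finset.mem_filter] at hr
      rw [hGg τ hτ (w, r) (mk_mem_prod hw (ball_subset_ball (by linarith) (mem_ball.mpr hr.2))) (hRroot r hr.1)]
    rw [Finset.sum_congr rfl hclus, LagrangeContour.coeff_interpolate_eq_sum]
    -- regroup the clusters
    have hbU : S₀.biUnion (fun τ ↦ R.filter fun r ↦ dist r τ < ε) = R := by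
      ext r
      simp only [Finset.mem_biUnion, Finset.mem_filter]
      constructor
      · rintro ⟨τ, -, hr, -⟩; exact hr
      · intro hr
        obtain ⟨τ, hτ, hrτ⟩ := hRball r hr
        exact ⟨τ, hτ, hr, mem_ball.mp hrτ⟩
    have hdisj : (↑S₀ : Set ℂ).PairwiseDisjoint fun τ ↦ R.filter fun r ↦ dist r τ < ε := by
      intro τ hτ τ' hτ' hne
      rw [Function.onFun, Finset.disjoint_filter]
      intro r _ h1 h2
      exact hne (huniq r τ hτ τ' hτ' (mem_ball.mpr h1) (mem_ball.mpr h2))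
    rw [← Finset.sum_biUnion hdisj, hbU]


/-- **The interpolation coefficients extend to entire functions.** With `δ ≠ 0` a polynomial off whose zeros `P_w`
has distinct roots, there is for each `j` an ENTIRE function `ã_j` on `ℂ^m` with `ã_j(w) = [X^j] L_w` whenever
`δ(w) ≠ 0` (`L_w` the Lagrange interpolant of `g(w, ·)` at the roots of `P_w`): `[X^j] L_w` is holomorphic off
`{δ = 0}` and locally bounded near it by `exists_local_interpolation`, and Riemann's extension theorem applies across
the thin set `{δ = 0}`. [cite: SerreGAGA1956, n° 20] [cite: Chirka1989, A1.4 (Riemann extension theorem)] -/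
theorem exists_differentiable_eq_coeff_interpolate (hc : c ≠ 0) (hPd : P.natDegree ≤ d)
    (hPlead : P.coeff d = MvPolynomial.C c) {L : ℝ} (hL : 1 ≤ L)
    (hroot : ∀ (w : Fin m → ℂ) (t : ℂ), (P.map (MvPolynomial.eval w)).IsRoot t → ‖t‖ ≤ L * (1 + ‖w‖))
    {g : (Fin m → ℂ) × ℂ → ℂ}
    (hhol : ∀ x : (Fin m → ℂ) × ℂ, (P.map (MvPolynomial.eval x.1)).eval x.2 = 0 →
      ∃ W : Set ((Fin m → ℂ) × ℂ), IsOpen W ∧ x ∈ W ∧ ∃ G : (Fin m → ℂ) × ℂ → ℂ, DifferentiableOn ℂ G W ∧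
        ∀ y ∈ W, (P.map (MvPolynomial.eval y.1)).eval y.2 = 0 → G y = g y)
    (δ : MvPolynomial (Fin m) ℂ) (hδ0 : δ ≠ 0)
    (hδ : ∀ w, MvPolynomial.eval w δ ≠ 0 → (P.map (MvPolynomial.eval w)).roots.Nodup) (j : ℕ) :
    ∃ a : (Fin m → ℂ) → ℂ, Differentiable ℂ a ∧ ∀ w, MvPolynomial.eval w δ ≠ 0 →
      a w = (interpolate (P.map (MvPolynomial.eval w)).roots.toFinset id fun r ↦ g (w, r)).coeff j := by
  classical
  set a : (Fin m → ℂ) → ℂ := fun w ↦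
    (interpolate (P.map (MvPolynomial.eval w)).roots.toFinset id fun r ↦ g (w, r)).coeff j with ha
  set Δ : Set (Fin m → ℂ) := {w | MvPolynomial.eval w δ = 0} with hΔ
  have hΔclosed : IsClosed Δ := isClosed_eq (BranchedCoveringSCV.differentiable_eval δ).continuous continuous_const
  have hloc := exists_local_interpolation P hc hPd hPlead hL hroot hhol j
  -- `a` is holomorphic off `Δ`
  have hadiff : DifferentiableOn ℂ a (univ \ Δ) := by
    intro w₀ hw₀
    have hw₀' : MvPolynomial.eval w₀ δ ≠ 0 := fun h ↦ hw₀.2 h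
    obtain ⟨δ', hδ', A, hA, hAeq⟩ := hloc w₀
    have hopen : IsOpen (ball w₀ δ' ∩ Δᶜ) := isOpen_ball.inter hΔclosed.isOpen_compl
    have hmem : w₀ ∈ ball w₀ δ' ∩ Δᶜ := ⟨mem_ball_self hδ', hw₀'⟩
    have heq : a =ᶠ[𝓝 w₀] A := by
      filter_upwards [hopen.mem_nhds hmem] with w hw
      exact (hAeq w hw.1 (hδ w hw.2)).symm
    exact (heq.differentiableAt_iff.mpr (hA.differentiableAt (isOpen_ball.mem_nhds (mem_ball_self hδ')))).differentiableWithinAt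
  -- `a` is locally bounded near `Δ`
  have hbdd : ∀ x ∈ Δ ∩ univ, ∃ W ∈ 𝓝 x, ∃ C : ℝ, ∀ y ∈ W \ Δ, ‖a y‖ ≤ C := by
    intro x _
    obtain ⟨δ', hδ', A, hA, hAeq⟩ := hloc x
    obtain ⟨C, hC⟩ := (isCompact_closedBall x (δ' / 2)).exists_bound_of_continuousOn
      (hA.continuousOn.mono (closedBall_subset_ball (by linarith)))
    refine ⟨closedBall x (δ' / 2), closedBall_mem_nhds x (by positivity), C, fun y hy ↦ ?_⟩
    have hy' : MvPolynomial.eval y δ ≠ 0 := fun h ↦ hy.2 h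
    have hay : a y = A y := (hAeq y (closedBall_subset_ball (by linarith) hy.1) (hδ y hy')).symm
    rw [hay]
    exact hC y hy.1
  -- thinness of `Δ`
  have hthin : ∀ x ∈ Δ ∩ univ, ∃ (φ : (Fin m → ℂ) → ℂ) (W : Set (Fin m → ℂ)), IsOpen W ∧ x ∈ W ∧ W ⊆ univ ∧
      DifferentiableOn ℂ φ W ∧ (∀ y ∈ Δ ∩ W, φ y = 0) ∧ ¬ φ =ᶠ[𝓝 x] 0 := fun x _ ↦
    ⟨fun w ↦ MvPolynomial.eval w δ, univ, isOpen_univ, mem_univ x, Subset.rfl,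
      (BranchedCoveringSCV.differentiable_eval δ).differentiableOn, fun y hy ↦ hy.1,
      fun hzero ↦ hδ0 (BranchedCoveringSCV.eq_zero_of_eventuallyEq_zero hzero)⟩
  have hUA : IsOpen (univ \ Δ) := by rw [← Set.compl_eq_univ_sdiff]; exact hΔclosed.isOpen_compl
  obtain ⟨ã, hãd, hãeq⟩ := SCV.exists_differentiableOn_eqOn_of_thin (f := a) hUA hthin hadiff hbdd
  refine ⟨ã, differentiableOn_univ.mp hãd, fun w hw ↦ ?_⟩
  exact hãeq ⟨mem_univ w, hw⟩

end AffineHypersurface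

end Literature.Analysis.Complex
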